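import Mathlib.Probability.Moments.ComplexMGF
import Summits.QuantumFields.YangMills.Theorems.TubeZeroFreeChannel.Negative.ZeroFreeAnalytic
import Summits.Ventures.LatticeQCDFlow.TrivializingMaps.FisherObstruction

/-!
HONEST FRAMING: exact (Metropolis-corrected) sampling algorithms for lattice gauge theory; figures of
merit are autocorrelation/cost numbers at stated couplings and volumes; no continuum-physics claim.

# ZeroPinching — COROLLARY N of THEORY-1.md §13.4, kernel-checked:
a real non-analyticity of the limiting free energy pinches Fisher zeros and kills every
volume-uniform trivializing-flow continuation

Proposed tree path: `Summits/Ventures/LatticeQCDFlow/TrivializingMaps/ZeroPinching.lean` (OURS — venture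
work, never `Literature/`). Cell `lqcd-flow` (pub-lqcd), unit `pub-lqcd-theory1-g12`, 2026-08-21.

## What is here (everything PROVED, 0 sorries, no new definitions)

COROLLARY N (THEORY-1 §13.4, justification as amended by the second-seat review R4/R4b): *if the
infinite-volume free energy `f(s) = -lim |Λ_L|⁻¹ log Z_{Λ_L}(s)` is not real-analytic at a real coupling
`s_c`, then `lim_L δ_L(s_c) = 0` (Fisher zeros of `Z_{Λ_L}` come arbitrarily close to `s_c` for ALL
large `L`), hence by THEOREM F no trivializing-flow family admits a flow constant `Ċ = Z'/Z` continuous on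
any fixed disc `B(s_c, r)` for large `L`: `ρ_L(s_c) → 0`.*

Part I is pure complex analysis for a sequence `Z n` of holomorphic functions on a disc `B(c, R)` about a
real point, real and positive on the diameter, with the volume bounds `e^{-K Vₙ} ≤ |Z n (c)|`,
`|Z n| ≤ e^{K Vₙ}`:
* `analyticAt_of_eventually_zeroFree` / `analyticAt_of_frequently_zeroFree`: if `Vₙ⁻¹ log |Z n x| → f x`
  on the real diameter and the `Z n` are zero-free on `B(c, R)` for all large `n` (resp. for infinitely
  many `n`), then `f` is real-analytic at `c` (holomorphic `V⁻¹ log Z` + Borel–Carathéodory + Vitali — the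
  single-limit specialisation of the tree theorem
  `Summit.QuantumFields.YangMills.Theorems.TubeZeroFreeChannel.Negative.analyticAt_of_uniformly_zeroFree`,
  plus a subsequence extraction for the `frequently` form = review point R4b);
* `exists_zero_eventually_of_not_analyticAt`: contrapositive — `¬ AnalyticAt ℝ f c` forces, for every
  `r > 0`, a zero of `Z n` in `B(c, r)` for ALL large `n` ("zeros pinch `c`").

Part II discharges every analytic hypothesis of Part I for GIBBS PARTITION FUNCTIONS, using Mathlib's
`ProbabilityTheory.complexMGF`: for probability spaces `(Ω n, ν n)` and real observables `X n` with the
extensivity bound `|X n| ≤ A·Vₙ` a.e., `Z n := complexMGF (X n) (ν n)`, `Z n s = ∫ exp (s · X n) dν n`, is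
entire, real-positive on `ℝ`, and obeys both volume bounds on `B(c, R)` with `K = (|c| + R)·A`
(`differentiable_complexMGF_of_abs_le`, `mgf_le_exp_of_abs_le`, `exp_neg_le_mgf_of_abs_le`). Hence:
* `pressure_analyticAt_of_frequently_zeroFree`: zero-freeness of `Z n` on a fixed complex disc about `c`
  for infinitely many `n` makes the limiting pressure `p x = lim Vₙ⁻¹ log mgf (X n) (ν n) x` analytic at `c`,
  indeed on the whole real diameter (`pressure_analyticOnNhd_of_frequently_zeroFree`: the Lee–Yang /
  Fisher mechanism "zero-free complex neighbourhood ⇒ analytic pressure");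
* `fisherZeros_pinch_of_not_analyticAt` (COROLLARY N, first half): `¬ AnalyticAt ℝ p c ⇒` for every
  `r > 0`, eventually every `Z n` has a zero in `B(c, r)`;
* `no_flowConstant_eventually_of_not_analyticAt` (COROLLARY N, second half, docked to
  `Fisher.no_continuous_flowConstant_at_zero` of `FisherObstruction.lean`): eventually NO continuous
  `C` on `B(c, r)` satisfies `(Z n)' = C · Z n` there.

## Dictionary (discharged on paper in THEORY-1 §13.1/§13.4; nothing below is claimed in Lean)
`Ω n = G^{E(Λ_n)}` (link configurations on the torus `Λ_n`, `G` compact), `ν n` = product Haar measure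
(a probability measure), `X n = -S₁` = minus the Wilson plaquette action (`|S₁| ≤ 2N · #plaquettes`, so
`A = N d(d-1)`, `Vₙ = |Λ_n|`), `complexMGF (X n) (ν n) s = ∫ e^{-s S₁} dU = Z_{Λ_n}(s)` and
`mgf (X n) (ν n) β = Z_{Λ_n}(β) > 0`; `p = -f` (pressure = minus the free-energy density; analyticity of
`p` and `f` at `c` are equivalent); `C = Ċ`, the flow constant of a trivializing flow, which satisfies
`Ċ · Z = Z'` by THEOREM F (Lüscher 2010, eqs. (4.5)–(4.10); `FisherObstruction.lean`). The hypothesis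
`¬ AnalyticAt ℝ p s_c` (a bulk transition) is PROVED IN PRINT for the van Enter–Shlosman nonlinear
plaquette actions (d ≥ 3) and the 4-d gauge Potts models, and is NUMERICAL ONLY for U(1) d = 4 Wilson at
`β_c ≈ 1.01` and SU(N ≥ 4) d = 4 (THEORY-1 §13.4); for SU(3) d = 4 Wilson no bulk transition is expected
and this file says nothing there.

References: S. Friedli, Y. Velenik, *Statistical Mechanics of Lattice Systems*, CUP 2017, Thm 3.42 and
its proof (Vitali + Hurwitz for pressures) [bib `FriedliVelenik2017`]; M. Lüscher, Commun. Math. Phys. 293 (2010)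
899 [arXiv:0907.5491], §4 (bib `Luscher2010Trivializing`); THEORY-1.md §13.1 (THEOREM F), §13.4
(COROLLARY N, review R4/R4b).
-/

noncomputable section

open Filter Topology Set Metric MeasureTheory ProbabilityTheory

namespace Summit.Ventures.LatticeQCDFlow.TrivializingMaps.ZeroPinching

open Summit.QuantumFields.YangMills.Theorems.TubeZeroFreeChannel.Negative
  (analyticAt_of_uniformly_zeroFree ofReal_mem_ball_iff)

/-! ### Part I. Sequences of zero-free holomorphic functions about a real point -/

section Analysis

variable {Z : ℕ → ℂ → ℂ} {V : ℕ → ℝ} {c R K : ℝ} {f : ℝ → ℝ}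

/-- **Eventual zero-freeness on a disc makes the limit of `Vₙ⁻¹ log |Z n|` analytic.** Let `Z n` be
holomorphic on `B(c, R)` (`c` real), real and positive on the diameter, with `e^{-K Vₙ} ≤ |Z n c|` and
`|Z n| ≤ e^{K Vₙ}` on the disc (`Vₙ ≥ 1`, `K ≥ 0`), zero-free on `B(c, R)` for all large `n`, and suppose
`Vₙ⁻¹ log |Z n x| → f x` at every real `x` of the diameter. Then `f` is real-analytic at `c`.
(Single-limit case of the YangMills tree theorem `analyticAt_of_uniformly_zeroFree`.) -/
theorem analyticAt_of_eventually_zeroFree (hR : 0 < R) (hK : 0 ≤ K) (hV : ∀ n, 1 ≤ V n)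
    (hZd : ∀ n, DifferentiableOn ℂ (Z n) (ball (c : ℂ) R))
    (hub : ∀ n, ∀ z ∈ ball (c : ℂ) R, ‖Z n z‖ ≤ Real.exp (K * V n))
    (hlb : ∀ n, Real.exp (-(K * V n)) ≤ ‖Z n c‖)
    (hreal : ∀ n, ∀ x : ℝ, (x : ℂ) ∈ ball (c : ℂ) R → ∃ y : ℝ, 0 < y ∧ Z n x = y)
    (hzf : ∀ᶠ n in atTop, ∀ z ∈ ball (c : ℂ) R, Z n z ≠ 0)
    (hf : ∀ x : ℝ, (x : ℂ) ∈ ball (c : ℂ) R →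
      Tendsto (fun n => Real.log ‖Z n x‖ / V n) atTop (𝓝 (f x))) :
    AnalyticAt ℝ f c := by
  obtain ⟨N, hN⟩ := eventually_atTop.1 hzf
  exact analyticAt_of_uniformly_zeroFree (Z := fun L _ => Z L) (V := fun L _ => V L)
    (e := fun L x => Real.log ‖Z L x‖ / V L) hR hK (fun L _ _ _ => hV L) (fun L _ _ _ => hZd L)
    (fun L _ _ _ => hub L) (fun L _ _ _ => hlb L) (fun L _ _ _ => hreal L)
    ⟨N, fun L hL => ⟨0, fun _ _ => hN L hL⟩⟩ ⟨0, fun _ _ _ _ => tendsto_const_nhds⟩ hf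

/-- **Zero-freeness for infinitely many `n` suffices** (review point R4b: the argument runs along every
subsequence). Same hypotheses as `analyticAt_of_eventually_zeroFree`, with the `Z n` zero-free on
`B(c, R)` only FREQUENTLY in `n`. -/
theorem analyticAt_of_frequently_zeroFree (hR : 0 < R) (hK : 0 ≤ K) (hV : ∀ n, 1 ≤ V n)
    (hZd : ∀ n, DifferentiableOn ℂ (Z n) (ball (c : ℂ) R))
    (hub : ∀ n, ∀ z ∈ ball (c : ℂ) R, ‖Z n z‖ ≤ Real.exp (K * V n))
    (hlb : ∀ n, Real.exp (-(K * V n)) ≤ ‖Z n c‖)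
    (hreal : ∀ n, ∀ x : ℝ, (x : ℂ) ∈ ball (c : ℂ) R → ∃ y : ℝ, 0 < y ∧ Z n x = y)
    (hzf : ∃ᶠ n in atTop, ∀ z ∈ ball (c : ℂ) R, Z n z ≠ 0)
    (hf : ∀ x : ℝ, (x : ℂ) ∈ ball (c : ℂ) R →
      Tendsto (fun n => Real.log ‖Z n x‖ / V n) atTop (𝓝 (f x))) :
    AnalyticAt ℝ f c := by
  obtain ⟨φ, hφ, hφP⟩ := extraction_of_frequently_atTop hzf
  exact analyticAt_of_eventually_zeroFree (Z := fun n => Z (φ n)) (V := fun n => V (φ n)) hR hK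
    (fun n => hV (φ n)) (fun n => hZd (φ n)) (fun n => hub (φ n)) (fun n => hlb (φ n))
    (fun n => hreal (φ n)) (Eventually.of_forall hφP)
    (fun x hx => (hf x hx).comp hφ.tendsto_atTop)

/-- **Zeros pinch a real non-analyticity point.** Under the standing hypotheses on `B(c, R)`, if the
limit `f` of `Vₙ⁻¹ log |Z n|` on the diameter is NOT real-analytic at `c`, then for every `r > 0` the
function `Z n` has a zero in `B(c, r)` for ALL large `n`; i.e. `dist(c, zeros of Z n) → 0`. -/
theorem exists_zero_eventually_of_not_analyticAt (hK : 0 ≤ K) (hV : ∀ n, 1 ≤ V n)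
    (hZd : ∀ n, DifferentiableOn ℂ (Z n) (ball (c : ℂ) R))
    (hub : ∀ n, ∀ z ∈ ball (c : ℂ) R, ‖Z n z‖ ≤ Real.exp (K * V n))
    (hlb : ∀ n, Real.exp (-(K * V n)) ≤ ‖Z n c‖)
    (hreal : ∀ n, ∀ x : ℝ, (x : ℂ) ∈ ball (c : ℂ) R → ∃ y : ℝ, 0 < y ∧ Z n x = y)
    (hf : ∀ x : ℝ, (x : ℂ) ∈ ball (c : ℂ) R →
      Tendsto (fun n => Real.log ‖Z n x‖ / V n) atTop (𝓝 (f x)))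
    (hna : ¬ AnalyticAt ℝ f c) (hR : 0 < R) {r : ℝ} (hr : 0 < r) :
    ∀ᶠ n in atTop, ∃ z ∈ ball (c : ℂ) r, Z n z = 0 := by
  -- it suffices to find zeros in the smaller disc `B(c, r')`, `r' = min r R`
  suffices h : ∀ᶠ n in atTop, ∃ z ∈ ball (c : ℂ) (min r R), Z n z = 0 by
    filter_upwards [h] with n hn
    obtain ⟨z, hz, hZ⟩ := hn
    exact ⟨z, ball_subset_ball (min_le_left r R) hz, hZ⟩
  by_contra h
  have hfreq : ∃ᶠ n in atTop, ∀ z ∈ ball (c : ℂ) (min r R), Z n z ≠ 0 :=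
    (not_eventually.1 h).mono fun n hn z hz hZ => hn ⟨z, hz, hZ⟩
  have hsub : ball (c : ℂ) (min r R) ⊆ ball (c : ℂ) R := ball_subset_ball (min_le_right r R)
  exact hna (analyticAt_of_frequently_zeroFree (lt_min hr hR) hK hV (fun n => (hZd n).mono hsub)
    (fun n z hz => hub n z (hsub hz)) hlb (fun n x hx => hreal n x (hsub hx)) hfreq
    (fun x hx => hf x (hsub hx)))

end Analysis

/-! ### Part II. Gibbs partition functions = complex moment generating functions of bounded observables -/

section Gibbs

variable {Ω : Type*} [MeasurableSpace Ω] {μ : Measure Ω} {X : Ω → ℝ} {b : ℝ}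

/-- A bounded observable has exponential moments of every order: `integrableExpSet X μ = univ`. -/
theorem integrableExpSet_eq_univ_of_abs_le [IsFiniteMeasure μ] (hm : AEMeasurable X μ)
    (hb : ∀ᵐ ω ∂μ, |X ω| ≤ b) : integrableExpSet X μ = univ :=
  eq_univ_of_forall fun _ =>
    integrable_exp_mul_of_mem_Icc hm (hb.mono fun _ h => mem_Icc.2 (abs_le.1 h))

/-- The complex MGF `s ↦ ∫ exp (s · X) dμ` of a bounded observable under a finite measure is ENTIRE
(Mathlib's `differentiableOn_complexMGF` on the strip over `integrableExpSet = univ`). -/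
theorem differentiable_complexMGF_of_abs_le [IsFiniteMeasure μ] (hm : AEMeasurable X μ)
    (hb : ∀ᵐ ω ∂μ, |X ω| ≤ b) : Differentiable ℂ (complexMGF X μ) := by
  have h : {z : ℂ | z.re ∈ interior (integrableExpSet X μ)} = univ := by
    rw [integrableExpSet_eq_univ_of_abs_le hm hb, interior_univ]
    exact eq_univ_of_forall fun _ => mem_univ _
  have hd := differentiableOn_complexMGF (X := X) (μ := μ)
  rw [h] at hd
  exact differentiableOn_univ.1 hd

/-- Upper volume bound: `mgf X μ t ≤ exp (|t| · b)` for `|X| ≤ b` a.e. under a probability measure. -/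
theorem mgf_le_exp_of_abs_le [IsProbabilityMeasure μ] (hm : AEMeasurable X μ)
    (hb : ∀ᵐ ω ∂μ, |X ω| ≤ b) (t : ℝ) : mgf X μ t ≤ Real.exp (|t| * b) := by
  have hint : Integrable (fun ω => Real.exp (t * X ω)) μ :=
    integrable_exp_mul_of_mem_Icc hm (hb.mono fun _ h => mem_Icc.2 (abs_le.1 h))
  calc mgf X μ t = ∫ ω, Real.exp (t * X ω) ∂μ := rfl
    _ ≤ ∫ _, Real.exp (|t| * b) ∂μ := by
        refine integral_mono_ae hint (integrable_const _) ?_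
        filter_upwards [hb] with ω hω
        refine Real.exp_le_exp.2 ((le_abs_self _).trans ?_)
        rw [abs_mul]
        exact mul_le_mul_of_nonneg_left hω (abs_nonneg t)
    _ = Real.exp (|t| * b) := by simp

/-- Lower volume bound: `exp (-(|t| · b)) ≤ mgf X μ t` for `|X| ≤ b` a.e. under a probability measure. -/
theorem exp_neg_le_mgf_of_abs_le [IsProbabilityMeasure μ] (hm : AEMeasurable X μ)
    (hb : ∀ᵐ ω ∂μ, |X ω| ≤ b) (t : ℝ) : Real.exp (-(|t| * b)) ≤ mgf X μ t := by
  have hint : Integrable (fun ω => Real.exp (t * X ω)) μ :=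
    integrable_exp_mul_of_mem_Icc hm (hb.mono fun _ h => mem_Icc.2 (abs_le.1 h))
  calc Real.exp (-(|t| * b)) = ∫ _, Real.exp (-(|t| * b)) ∂μ := by simp
    _ ≤ ∫ ω, Real.exp (t * X ω) ∂μ := by
        refine integral_mono_ae (integrable_const _) hint ?_
        filter_upwards [hb] with ω hω
        refine Real.exp_le_exp.2 ?_
        have h1 : -|t * X ω| ≤ t * X ω := neg_abs_le _
        have h2 : |t * X ω| ≤ |t| * b := by
          rw [abs_mul]; exact mul_le_mul_of_nonneg_left hω (abs_nonneg t)
        linarith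
    _ = mgf X μ t := rfl

/-- On the real axis the complex MGF of a bounded observable under a probability measure is a
POSITIVE REAL number (`= mgf X μ x`). -/
theorem complexMGF_ofReal_pos [IsProbabilityMeasure μ] (hm : AEMeasurable X μ)
    (hb : ∀ᵐ ω ∂μ, |X ω| ≤ b) (x : ℝ) : ∃ y : ℝ, 0 < y ∧ complexMGF X μ x = y :=
  ⟨mgf X μ x, mgf_pos (integrable_exp_mul_of_mem_Icc hm (hb.mono fun _ h => mem_Icc.2 (abs_le.1 h))),
    complexMGF_ofReal x⟩

/-- `‖complexMGF X μ x‖ = mgf X μ x` at real points. -/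
theorem norm_complexMGF_ofReal [IsProbabilityMeasure μ] (x : ℝ) :
    ‖complexMGF X μ x‖ = mgf X μ x := by
  rw [complexMGF_ofReal, Complex.norm_real, Real.norm_eq_abs, abs_of_nonneg mgf_nonneg]

/-- Uniform bound on a disc about a real centre: for `z ∈ B(c, R)` and `|X| ≤ b` a.e.,
`‖complexMGF X μ z‖ ≤ exp ((|c| + R) · b)`. -/
theorem norm_complexMGF_le_of_mem_ball [IsProbabilityMeasure μ] (hm : AEMeasurable X μ)
    (hb : ∀ᵐ ω ∂μ, |X ω| ≤ b) (hb0 : 0 ≤ b) {c R : ℝ} {z : ℂ} (hz : z ∈ ball (c : ℂ) R) :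
    ‖complexMGF X μ z‖ ≤ Real.exp ((|c| + R) * b) := by
  refine (norm_complexMGF_le_mgf.trans (mgf_le_exp_of_abs_le hm hb z.re)).trans ?_
  refine Real.exp_le_exp.2 (mul_le_mul_of_nonneg_right ?_ hb0)
  have h1 : |z.re - c| ≤ ‖z - (c : ℂ)‖ := by
    have := Complex.abs_re_le_norm (z - (c : ℂ))
    simpa using this
  have h2 : ‖z - (c : ℂ)‖ < R := by rwa [mem_ball, dist_eq_norm] at hz
  have h3 : |z.re| ≤ |z.re - c| + |c| := by
    have := abs_add_le (z.re - c) c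
    simpa using this
  linarith

end Gibbs

/-! ### Part III. COROLLARY N for Gibbs partition functions -/

section CorollaryN

variable {Ω : ℕ → Type*} [∀ n, MeasurableSpace (Ω n)] {ν : ∀ n, Measure (Ω n)}
  [∀ n, IsProbabilityMeasure (ν n)] {X : ∀ n, Ω n → ℝ} {V : ℕ → ℝ} {A c R : ℝ} {p : ℝ → ℝ}

/-- **Zero-freeness of the partition functions on a fixed complex disc, for infinitely many volumes,
makes the limiting pressure analytic.** Probability spaces `(Ω n, ν n)`, real observables `X n` with
`|X n| ≤ A · Vₙ` a.e. (`Vₙ ≥ 1`, `A ≥ 0`), `Z n := complexMGF (X n) (ν n)`; if `Z n` is zero-free on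
`B(c, R)` for infinitely many `n` and `Vₙ⁻¹ log mgf (X n) (ν n) x → p x` for real `|x - c| < R`, then `p`
is real-analytic at `c`. -/
theorem pressure_analyticAt_of_frequently_zeroFree (hXm : ∀ n, AEMeasurable (X n) (ν n))
    (hV : ∀ n, 1 ≤ V n) (hA : 0 ≤ A) (hXb : ∀ n, ∀ᵐ ω ∂(ν n), |X n ω| ≤ A * V n) (hR : 0 < R)
    (hzf : ∃ᶠ n in atTop, ∀ z ∈ ball (c : ℂ) R, complexMGF (X n) (ν n) z ≠ 0)
    (hp : ∀ x : ℝ, |x - c| < R →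
      Tendsto (fun n => Real.log (mgf (X n) (ν n) x) / V n) atTop (𝓝 (p x))) :
    AnalyticAt ℝ p c := by
  have hAV : ∀ n, 0 ≤ A * V n := fun n => mul_nonneg hA (le_trans zero_le_one (hV n))
  refine analyticAt_of_frequently_zeroFree (Z := fun n => complexMGF (X n) (ν n)) (V := V)
    (K := (|c| + R) * A) hR (by positivity) hV
    (fun n => (differentiable_complexMGF_of_abs_le (hXm n) (hXb n)).differentiableOn)
    (fun n z hz => ?_) (fun n => ?_) (fun n x _ => complexMGF_ofReal_pos (hXm n) (hXb n) x) hzf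
    (fun x hx => ?_)
  · have h := norm_complexMGF_le_of_mem_ball (hXm n) (hXb n) (hAV n) hz
    simpa [mul_assoc] using h
  · have h := exp_neg_le_mgf_of_abs_le (hXm n) (hXb n) c
    rw [norm_complexMGF_ofReal]
    refine le_trans (Real.exp_le_exp.2 ?_) h
    have hc : |c| * (A * V n) ≤ (|c| + R) * A * V n := by
      rw [mul_assoc]
      exact mul_le_mul_of_nonneg_right (by linarith) (hAV n)
    linarith
  · have hx' : |x - c| < R := ofReal_mem_ball_iff.1 hx
    refine (hp x hx').congr fun n => ?_
    rw [norm_complexMGF_ofReal]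

/-- **Lee–Yang/Fisher form on the whole diameter.** In the setting of
`pressure_analyticAt_of_frequently_zeroFree`, the limiting pressure is real-analytic at EVERY real
point of the zero-free disc: `AnalyticOnNhd ℝ p (c - R, c + R)` (apply the previous theorem on the discs
`B(x, R - |x - c|) ⊆ B(c, R)`; the lower volume bound holds at every real centre). -/
theorem pressure_analyticOnNhd_of_frequently_zeroFree (hXm : ∀ n, AEMeasurable (X n) (ν n))
    (hV : ∀ n, 1 ≤ V n) (hA : 0 ≤ A) (hXb : ∀ n, ∀ᵐ ω ∂(ν n), |X n ω| ≤ A * V n)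
    (hzf : ∃ᶠ n in atTop, ∀ z ∈ ball (c : ℂ) R, complexMGF (X n) (ν n) z ≠ 0)
    (hp : ∀ x : ℝ, |x - c| < R →
      Tendsto (fun n => Real.log (mgf (X n) (ν n) x) / V n) atTop (𝓝 (p x))) :
    AnalyticOnNhd ℝ p (Ioo (c - R) (c + R)) := by
  intro x hx
  have hxc : |x - c| < R := by rw [abs_lt]; constructor <;> linarith [hx.1, hx.2]
  have hR' : 0 < R - |x - c| := by linarith
  have hsub : ball (x : ℂ) (R - |x - c|) ⊆ ball (c : ℂ) R := by
    intro z hz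
    rw [mem_ball] at hz ⊢
    have hxcd : dist (x : ℂ) (c : ℂ) = |x - c| := by
      rw [dist_eq_norm, ← Complex.ofReal_sub, Complex.norm_real, Real.norm_eq_abs]
    linarith [dist_triangle z (x : ℂ) (c : ℂ)]
  refine pressure_analyticAt_of_frequently_zeroFree hXm hV hA hXb hR'
    (hzf.mono fun n hn z hz => hn z (hsub hz)) fun y hy => hp y ?_
  calc |y - c| ≤ |y - x| + |x - c| := abs_sub_le y x c
    _ < R := by linarith

/-- **COROLLARY N, first half: Fisher zeros pinch a bulk transition.** In the setting of
`pressure_analyticAt_of_frequently_zeroFree`, if the limiting pressure `p` is NOT real-analytic at `c`,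
then for every `r > 0` the partition function `complexMGF (X n) (ν n)` has a zero in the complex disc
`B(c, r)` for ALL large `n`: `δ_n(c) := dist(c, Fisher zeros at volume n) → 0`. -/
theorem fisherZeros_pinch_of_not_analyticAt (hXm : ∀ n, AEMeasurable (X n) (ν n))
    (hV : ∀ n, 1 ≤ V n) (hA : 0 ≤ A) (hXb : ∀ n, ∀ᵐ ω ∂(ν n), |X n ω| ≤ A * V n)
    (hp : ∀ x : ℝ, |x - c| < R →
      Tendsto (fun n => Real.log (mgf (X n) (ν n) x) / V n) atTop (𝓝 (p x)))
    (hna : ¬ AnalyticAt ℝ p c) (hR : 0 < R) {r : ℝ} (hr : 0 < r) :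
    ∀ᶠ n in atTop, ∃ s ∈ ball (c : ℂ) r, complexMGF (X n) (ν n) s = 0 := by
  suffices h : ∀ᶠ n in atTop, ∃ s ∈ ball (c : ℂ) (min r R), complexMGF (X n) (ν n) s = 0 by
    filter_upwards [h] with n hn
    obtain ⟨s, hs, hZ⟩ := hn
    exact ⟨s, ball_subset_ball (min_le_left r R) hs, hZ⟩
  by_contra h
  have hfreq : ∃ᶠ n in atTop, ∀ z ∈ ball (c : ℂ) (min r R), complexMGF (X n) (ν n) z ≠ 0 :=
    (not_eventually.1 h).mono fun n hn z hz hZ => hn ⟨z, hz, hZ⟩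
  exact hna (pressure_analyticAt_of_frequently_zeroFree hXm hV hA hXb (lt_min hr hR) hfreq
    fun x hx => hp x (lt_of_lt_of_le hx (min_le_right r R)))

/-- **COROLLARY N, second half: no volume-uniform trivializing-flow continuation through a bulk
transition** (docked to THEOREM F, `Fisher.no_continuous_flowConstant_at_zero`). In the setting of
`fisherZeros_pinch_of_not_analyticAt`: for every `r > 0` and all large `n` there is NO function `C`
continuous on `B(c, r)` with `(Z n)' = C · Z n` there — in the dictionary, no trivializing flow on `Λ_n`
has a flow constant `Ċ` (hence a flow action) continuous in `s = tβ` on `B(s_c, r)`: `ρ_n(s_c) → 0`. -/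
theorem no_flowConstant_eventually_of_not_analyticAt (hXm : ∀ n, AEMeasurable (X n) (ν n))
    (hV : ∀ n, 1 ≤ V n) (hA : 0 ≤ A) (hXb : ∀ n, ∀ᵐ ω ∂(ν n), |X n ω| ≤ A * V n)
    (hp : ∀ x : ℝ, |x - c| < R →
      Tendsto (fun n => Real.log (mgf (X n) (ν n) x) / V n) atTop (𝓝 (p x)))
    (hna : ¬ AnalyticAt ℝ p c) (hR : 0 < R) {r : ℝ} (hr : 0 < r) :
    ∀ᶠ n in atTop, ¬ ∃ C : ℂ → ℂ, ContinuousOn C (ball (c : ℂ) r) ∧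
      ∀ s ∈ ball (c : ℂ) r, deriv (complexMGF (X n) (ν n)) s = C s * complexMGF (X n) (ν n) s := by
  filter_upwards [fisherZeros_pinch_of_not_analyticAt hXm hV hA hXb hp hna hR hr] with n hn
  obtain ⟨z₀, hz₀, hZ⟩ := hn
  obtain ⟨y, hy, hyc⟩ := complexMGF_ofReal_pos (hXm n) (hXb n) c
  have hc0 : complexMGF (X n) (ν n) c ≠ 0 := by
    rw [hyc]; exact_mod_cast hy.ne'
  exact Fisher.no_continuous_flowConstant_at_zero isOpen_ball (convex_ball _ _).isPreconnected
    (differentiable_complexMGF_of_abs_le (hXm n) (hXb n)).differentiableOn (mem_ball_self hr) hc0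
    hz₀ hZ

end CorollaryN

end Summit.Ventures.LatticeQCDFlow.TrivializingMaps.ZeroPinching
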